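import Summits.CriticalPhenomena.Ising3D.Control2DOpeEpsKernelSharp
import Mathlib.Tactic.Linarith
import Mathlib.Tactic.Positivity
import Mathlib.Tactic.FieldSimp
import Mathlib.Tactic.Ring
import Mathlib.Tactic.LinearCombination
import HarnessLib

/-!
# Kind `ope2eps`: the ZERO-TAIL truncation `ptruncZ` of a kernel leaf polynomial and the LOWER sign leaves through it
(cell `pub-ising3x`, seat controls-1 gen 25; KERNEL PATH for the 2D γ-certificates, kind `ope2eps` — CONTROL-ONLY)

HONEST FRAMING: lottery ticket; floor = tightest certified 3D Ising CFT bounds; no exact-solution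
claim without a proof. CONTROL-ONLY (`d = 2`, axiom set `A2D′`); nothing numerical is asserted here.

WHY (measured, controls-1 g24/g25): the ε-box LOWER sign leaf of `Control2DOpeEpsKernel` / `…KernelSharp` is ONE decision
`bernAuto (ptrunc (epsLowerPolyZ… - 1) m) q a L` on a polynomial of degree `≈ 4 Nd` (`Nd = 79`: 326 coefficients) whose
coefficients beyond the first `≈ 70` are tiny and NEGATIVE, so the floor truncation `ptrunc` turns them into a dense tail of `-1`
entries; the kernel's evaluation of the Bernstein transform on such a tail is super-linear in its length (first 120 coefficients:
87 s; all 326: > 900 s, gate timeout 600 s), while the same check with the tail replaced by zeros and trimmed (degree 72) takes 6 s.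

WHAT: `ptruncZ p m` floor-divides the coefficients with `|c| ≥ 10^m` by `10^m`, replaces the others by `0`, charges the constant
term with their number and drops trailing zeros. On `0 ≤ y ≤ 1` this is again a lower bound: `10^m · (ptruncZ p m)(y) ≤ p(y)`
(`pow_mul_evalR_ptruncZ_le`; each zeroed term satisfies `c y^k ≥ -10^m`). Hence `bernAuto (ptruncZ p m) q a L = true` with
`a + L ≤ q` gives `p ≥ 0` on the cell (`evalR_nonneg_of_bernAuto_truncZ`), and the two LOWER sign leaves follow with the proofs of
`epsSignLower_of_bernAuto_trunc` / `epsSignLowerB_of_bernAuto_trunc` unchanged after their first step (stated here once from the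
polynomial inequality: `epsSignLower_of_evalR_nonneg`, `epsSignLowerB_of_evalR_nonneg`). The ε box has `y ≤ 20001/40000 < 1`.
PROVED; no facts, standard axioms only. Exact mirror: HOME/code/controls/kp11/kmirror11.py (`ptruncZ`).
[cite: RattazziEtAl2008, §5]
-/

namespace Summit.CriticalPhenomena.Ising3D.Control2D

open Finset Set
open Literature.Analysis.ValidatedNumerics.PolyMP
open Literature.MathematicalPhysics.QuantumFieldTheory.ConformalBootstrap3D

/-! ### The zero-tail truncation -/

/-- One coefficient: `0` if `|c| < 10^m`, else the floor quotient `c / 10^m`. [folklore] -/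
def ztz (m : ℕ) (c : ℤ) : ℤ := if c.natAbs < 10 ^ m then 0 else c / (10 : ℤ) ^ m

/-- The number of coefficients with `|c| < 10^m` (those `ztz` replaces by `0`). [folklore] -/
def nsmall (m : ℕ) : List ℤ → ℕ
  | [] => 0
  | c :: cs => (if c.natAbs < 10 ^ m then 1 else 0) + nsmall m cs

/-- Drop trailing zeros (the polynomial is unchanged). [folklore] -/
def ztrim : List ℤ → List ℤ
  | [] => []
  | c :: cs =>
    match ztrim cs with
    | [] => if c = 0 then [] else [c]
    | d :: ds => c :: d :: ds

/-- **Zero-tail truncation**: `ztz` every coefficient, charge the constant term with the number of zeroed ones, trim. [folklore] -/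
def ptruncZ (p : List ℤ) (m : ℕ) : List ℤ :=
  match p with
  | [] => []
  | c :: cs => ztrim ((ztz m c - (nsmall m (c :: cs) : ℤ)) :: cs.map (ztz m))

/-- [folklore] -/
theorem evalR_ztrim (y : ℝ) : ∀ p : List ℤ, evalR (castZ (ztrim p)) y = evalR (castZ p) y
  | [] => rfl
  | c :: cs => by
      have ih := evalR_ztrim y cs
      show evalR (castZ (match ztrim cs with | [] => if c = 0 then [] else [c] | d :: ds => c :: d :: ds)) y = _
      rcases h : ztrim cs with _ | ⟨d, ds⟩
      · rw [h] at ih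
        simp only [castZ_nil, evalR_nil] at ih
        split_ifs with hc
        · rw [castZ_cons, evalR_cons, ← ih, hc, castZ_nil, evalR_nil]; simp
        · rw [castZ_cons, castZ_cons, castZ_nil, evalR_cons, evalR_cons, evalR_nil, ← ih]
      · rw [h] at ih
        simp only [castZ_cons, evalR_cons] at ih ⊢
        rw [ih]

/-- One coefficient: `10^m · ztz m c - 10^m · [|c| < 10^m] ≤ c`. [folklore] -/
theorem pow_mul_ztz_le (m : ℕ) (c : ℤ) :
    (10 : ℤ) ^ m * ztz m c - (10 : ℤ) ^ m * (if c.natAbs < 10 ^ m then 1 else 0) ≤ c := by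
  unfold ztz
  split_ifs with h
  · have h' : ((c.natAbs : ℕ) : ℤ) < (10 : ℤ) ^ m := by exact_mod_cast h
    have h1 : -c ≤ (((-c).natAbs : ℕ) : ℤ) := Int.le_natAbs
    rw [Int.natAbs_neg] at h1
    linarith
  · have hM : (0 : ℤ) < (10 : ℤ) ^ m := by positivity
    have h2 : (10 : ℤ) ^ m * (c / (10 : ℤ) ^ m) ≤ c := Int.mul_ediv_self_le hM.ne'
    linarith

/-- The map-and-count bound on `[0, 1]`: `10^m · (map ztz p)(y) - 10^m · nsmall ≤ p(y)`. [folklore] -/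
theorem pow_mul_evalR_map_ztz_le (m : ℕ) {y : ℝ} (hy0 : 0 ≤ y) (hy1 : y ≤ 1) :
    ∀ p : List ℤ, (10 : ℝ) ^ m * evalR (castZ (p.map (ztz m))) y - (10 : ℝ) ^ m * (nsmall m p : ℝ) ≤ evalR (castZ p) y
  | [] => by simp [castZ, nsmall]
  | c :: cs => by
      have ih := pow_mul_evalR_map_ztz_le m hy0 hy1 cs
      have hc := pow_mul_ztz_le m c
      have hcR : (10 : ℝ) ^ m * ((ztz m c : ℤ) : ℝ) - (10 : ℝ) ^ m * ((if c.natAbs < 10 ^ m then 1 else 0 : ℕ) : ℝ) ≤ (c : ℝ) := by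
        have : (((10 : ℤ) ^ m * ztz m c - (10 : ℤ) ^ m * (if c.natAbs < 10 ^ m then 1 else 0) : ℤ) : ℝ) ≤ ((c : ℤ) : ℝ) := by
          exact_mod_cast hc
        push_cast at this
        convert this using 2
        split_ifs <;> simp
      simp only [List.map_cons, castZ_cons, evalR_cons, nsmall, Nat.cast_add]
      have hM : (0 : ℝ) ≤ (10 : ℝ) ^ m := by positivity
      have hn : (0 : ℝ) ≤ (nsmall m cs : ℝ) := by positivity
      -- `y · (10^m E' - 10^m n') ≤ y · E(cs)` and `-(10^m n') ≤ -y (10^m n')`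
      have h1 : y * ((10 : ℝ) ^ m * evalR (castZ (cs.map (ztz m))) y - (10 : ℝ) ^ m * (nsmall m cs : ℝ)) ≤
          y * evalR (castZ cs) y := mul_le_mul_of_nonneg_left ih hy0
      have h2 : (10 : ℝ) ^ m * (nsmall m cs : ℝ) * y ≤ (10 : ℝ) ^ m * (nsmall m cs : ℝ) := by
        have := mul_le_mul_of_nonneg_left hy1 (mul_nonneg hM hn); simpa using this
      nlinarith [h1, h2, hcR]

/-- **Zero-tail truncation is a lower bound on `[0, 1]`**: `10^m · (ptruncZ p m)(y) ≤ p(y)`. [folklore] -/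
theorem pow_mul_evalR_ptruncZ_le (m : ℕ) {y : ℝ} (hy0 : 0 ≤ y) (hy1 : y ≤ 1) :
    ∀ p : List ℤ, (10 : ℝ) ^ m * evalR (castZ (ptruncZ p m)) y ≤ evalR (castZ p) y
  | [] => by simp [ptruncZ, castZ]
  | c :: cs => by
      have h := pow_mul_evalR_map_ztz_le m hy0 hy1 (c :: cs)
      rw [ptruncZ, evalR_ztrim]
      simp only [List.map_cons, castZ_cons, evalR_cons, Int.cast_sub, Int.cast_natCast] at h ⊢
      linarith

/-- From a zero-tail-truncated Bernstein decision to the exact inequality `p(y) ≥ 0` on a cell inside `[0, 1]`. [folklore] -/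
theorem evalR_nonneg_of_bernAuto_truncZ {p : List ℤ} {m : ℕ} {q a L : ℤ} (hq : 0 < q) (ha : 0 ≤ a) (hL : 0 ≤ L)
    (hqL : a + L ≤ q) (hchk : bernAuto (ptruncZ p m) q a L = true) {y : ℝ} (hlo : (a : ℝ) / q ≤ y)
    (hhi : y ≤ ((a : ℝ) + L) / q) : 0 ≤ evalR (castZ p) y := by
  have hqR : (0 : ℝ) < q := by exact_mod_cast hq
  have hy : 0 ≤ y := le_trans (by positivity) hlo
  have hy1 : y ≤ 1 := by
    have h1 : ((a : ℝ) + L) / q ≤ 1 := by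
      rw [div_le_one hqR]; exact_mod_cast hqL
    linarith
  have h := evalR_nonneg_of_bernAuto hq hL hchk hlo hhi
  have hle := pow_mul_evalR_ptruncZ_le m hy hy1 p
  have hM : (0 : ℝ) < (10 : ℝ) ^ m := by positivity
  nlinarith [hle, mul_nonneg hM.le h]

/-! ### The LOWER sign leaf from the polynomial inequality (coarse tail) -/

set_option maxHeartbeats 800000 in
/-- The sign check of `opeEpsLower_half_of_cellsN` at `Δ` with the margin at any `y₂ ≥ Δ/2`, from
`0 ≤ (epsLowerPolyZ - 1)(Δ/2)` (`0 ≤ Δ`, `Λ < Nd + 4`): the body of `epsSignLower_of_bernAuto_trunc`. [folklore] -/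
theorem epsSignLower_of_evalR_nonneg (wt : ℕ × ℕ → ℤ) {Sl : List (ℕ × ℕ)} (hnd : Sl.Nodup) {Λ : ℕ}
    (hΛ : ∀ p ∈ Sl, p.1 + p.2 ≤ Λ) (Nd : ℕ) (hΛN : Λ < Nd + 4) {Δ y₂ : ℝ} (hΔ : 0 ≤ Δ) (hy₂ : Δ / 2 ≤ y₂)
    (h : 0 ≤ evalR (castZ (zadd (epsLowerPolyZ wt Sl Λ Nd) [-1])) (Δ / 2)) :
    (2 : ℝ) ^ Δ * taylorFunctional2D (1 / 2) Sl.toFinset (fun p => (wt p : ℝ)) (crossF (1 / 8) (-1) (QN (Nd + 1) 0 Δ)) +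
        (1 / 2 : ℝ) ^ (1 / 8 : ℝ) * (1 / 2 : ℝ) ^ (1 / 8 : ℝ) * (2 * absWeight Sl.toFinset (fun p => (wt p : ℝ))) *
          ((4 * tailMajor Λ (Nd + 1 + 2)) * (2 * headMajor Λ (Nd + 1) + 4 * tailMajor Λ (Nd + 1 + 2))) ≤
      -epsLowerMargin Λ Nd y₂ := by
  rw [evalR_zadd] at h
  have hm1 : evalR (castZ [-1]) (Δ / 2) = -1 := by simp
  rw [hm1] at h
  -- atoms
  set Pv := evalR (castZ (cellPolyZ wt Sl Λ 0 Nd)) (Δ / 2) with hPv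
  set DD := denProd Nd 0 (Δ / 2) * denProd Nd 0 (Δ / 2) with hDD
  set c1 : ℝ := ((epsC1 Λ Nd : ℕ) : ℝ) with hc1
  set Kr : ℝ := ((epsKZ wt Sl Λ Nd : ℤ) : ℝ) with hKr
  set c2 : ℝ := (1 / 2 : ℝ) ^ (1 / 8 : ℝ) * (1 / 2 : ℝ) ^ (1 / 8 : ℝ) with hc2def
  set Wr := absWeight Sl.toFinset (fun p => (wt p : ℝ)) with hWr
  set X := (2 : ℝ) ^ Δ * taylorFunctional2D (1 / 2) Sl.toFinset (fun p => (wt p : ℝ)) (crossF (1 / 8) (-1) (QN (Nd + 1) 0 Δ)) with hX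
  set Tr := c2 * (2 * Wr) * ((4 * tailMajor Λ (Nd + 1 + 2)) * (2 * headMajor Λ (Nd + 1) + 4 * tailMajor Λ (Nd + 1 + 2))) with hTr
  have hev : evalR (castZ (epsLowerPolyZ wt Sl Λ Nd)) (Δ / 2) = -c1 * Pv - Kr * DD := by
    rw [epsLowerPolyZ, evalR_zadd, evalR_zsmul, evalR_zsmul, evalR_zmul, evalR_dpolyZ, hc1, hKr, hPv, hDD]
    push_cast
    ring
  rw [hev] at h
  -- positivity of the atoms
  have hc2pos : 0 < c2 := by
    have : (0 : ℝ) < (1 / 2 : ℝ) ^ (1 / 8 : ℝ) := Real.rpow_pos_of_pos (by norm_num) _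
    rw [hc2def]; positivity
  have hD : 0 < denProd Nd 0 (Δ / 2) := denProd_pos Nd 0 (by push_cast; linarith)
  have hDm : denProd Nd 0 (Δ / 2) ≤ denProd Nd 0 y₂ := denProd_zero_mono Nd (by linarith) hy₂
  have hc1pos : 0 < c1 := by rw [hc1]; exact_mod_cast epsC1_pos hΛN
  have hdpos : 0 < Nd + 1 + 3 - Λ := by omega
  have hdR : (((Nd + 1 + 3 - Λ : ℕ)) : ℝ) = (Nd : ℝ) + 1 + 3 - Λ := by
    rw [Nat.cast_sub (by omega)]; push_cast; ring
  set M1 : ℝ := 8 ^ Λ * (Λ.factorial : ℝ) * (Λ.factorial : ℝ) * (4 : ℝ) ^ Nd * DD with hM1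
  have hM1pos : 0 < M1 := by rw [hM1, hDD]; positivity
  -- the block identity `M1 · X = c2 · P̂₀(y)`
  have hQ : M1 * X = c2 * Pv := by
    have hkey := two_rpow_mul_phiQ_eq wt hnd hΛ Nd hΔ
    rw [pow_two] at hkey
    rw [hM1, hDD, hX, hc2def, hPv]
    linear_combination hkey
  -- the tail identity `M1 · Tr · c1 = c2 · Kr · DD`
  have hW := cast_wabsZ wt hnd
  have hσ : 4 * tailMajor Λ (Nd + 1 + 2) = ((epsA Λ Nd : ℕ) : ℝ) / (2 ^ (Nd + 1) * (((Nd + 1 + 3 - Λ : ℕ)) : ℝ)) := by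
    rw [tailMajor, epsA, ← Nat.choose_eq_descFactorial_div_factorial, hdR, one_div_pow, pow_add]
    have hd0 : ((Nd + 1 + 2 : ℕ) : ℝ) + 1 - Λ = (Nd : ℝ) + 1 + 3 - Λ := by push_cast; ring
    have hd1 : ((Nd + 1 + 2 : ℕ) : ℝ) + 1 = (Nd : ℝ) + 1 + 3 := by push_cast; ring
    have hne : (Nd : ℝ) + 1 + 3 - Λ ≠ 0 := by rw [← hdR]; exact_mod_cast hdpos.ne'
    rw [hd0, hd1, show Nd + 1 + 2 + Λ = Nd + 1 + Λ + 2 by ring]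
    push_cast
    field_simp
    ring
  have hH : headMajor Λ (Nd + 1) = ((headMajorK Λ (Nd + 1) (Nd + 1) : ℕ) : ℝ) / 2 ^ (Nd + 1) := by
    rw [headMajor_eq, headMajorK_eq, headMajorZ]
  have hT : M1 * Tr * c1 = c2 * Kr * DD := by
    rw [hTr, hσ, hH, hM1, hKr, hc1, hWr, ← hW, epsKZ, epsC1]
    have hd0 : ((((Nd + 1 + 3 - Λ : ℕ)) : ℝ)) ≠ 0 := by exact_mod_cast hdpos.ne'
    have h4 : (4 : ℝ) ^ (Nd + 1) = 2 ^ (Nd + 1) * 2 ^ (Nd + 1) := by rw [← mul_pow]; norm_num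
    push_cast
    rw [h4]
    field_simp
  -- `h : 0 ≤ -c1 Pv - Kr DD - 1` ⇒ `M1 (X + Tr) c1 = c2 (c1 Pv + Kr DD) ≤ -c2`
  have hsum : M1 * (X + Tr) * c1 ≤ -c2 := by
    have h3 : c1 * Pv + Kr * DD ≤ -1 := by linarith
    have h4 : M1 * (X + Tr) * c1 = c2 * (c1 * Pv + Kr * DD) := by
      calc M1 * (X + Tr) * c1 = c1 * (M1 * X) + M1 * Tr * c1 := by ring
        _ = c1 * (c2 * Pv) + c2 * Kr * DD := by rw [hQ, hT]
        _ = c2 * (c1 * Pv + Kr * DD) := by ring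
    rw [h4]
    have h5 := mul_le_mul_of_nonneg_left h3 hc2pos.le
    linarith
  have hle1 : X + Tr ≤ -c2 / (M1 * c1) := by
    rw [le_div_iff₀ (mul_pos hM1pos hc1pos)]
    nlinarith [hsum]
  -- the margin at `Δ/2` dominates the one at the right end `y₂`
  have hmargin : epsLowerMargin Λ Nd y₂ ≤ c2 / (M1 * c1) := by
    unfold epsLowerMargin
    rw [← hc2def, ← hc1, hM1, hDD]
    have hD2 : 0 < denProd Nd 0 y₂ := lt_of_lt_of_le hD hDm
    rw [div_le_div_iff₀ (by positivity) (by positivity)]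
    have hsq : denProd Nd 0 (Δ / 2) * denProd Nd 0 (Δ / 2) ≤ (denProd Nd 0 y₂) ^ 2 := by
      rw [pow_two]; exact mul_le_mul hDm hDm hD.le hD2.le
    have hrest : 0 ≤ c2 * (8 ^ Λ * (Λ.factorial : ℝ) * (Λ.factorial : ℝ) * (4 : ℝ) ^ Nd * c1) := by positivity
    nlinarith [mul_le_mul_of_nonneg_left hsq hrest]
  have hneg : -c2 / (M1 * c1) = -(c2 / (M1 * c1)) := neg_div _ _
  rw [hneg] at hle1
  linarith

/-- **LOWER sign leaf with the integer tail, ZERO-TAIL truncation**: as `epsSignLower_of_bernAuto_trunc` with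
`bernAuto (ptruncZ (epsLowerPolyZ - 1) m) q a L = true` and the extra cell condition `a + L ≤ q` (`y ≤ 1`). [folklore] -/
theorem epsSignLower_of_bernAuto_truncZ (wt : ℕ × ℕ → ℤ) {Sl : List (ℕ × ℕ)} (hnd : Sl.Nodup) {Λ : ℕ}
    (hΛ : ∀ p ∈ Sl, p.1 + p.2 ≤ Λ) (Nd m : ℕ) (hΛN : Λ < Nd + 4) {q a L : ℤ} (hq : 0 < q) (ha : 0 ≤ a) (hL : 0 ≤ L)
    (hqL : a + L ≤ q) (hchk : bernAuto (ptruncZ (zadd (epsLowerPolyZ wt Sl Λ Nd) [-1]) m) q a L = true) {Δ : ℝ}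
    (hlo : 2 * (a : ℝ) / q ≤ Δ) (hhi : Δ ≤ 2 * ((a : ℝ) + L) / q) :
    (2 : ℝ) ^ Δ * taylorFunctional2D (1 / 2) Sl.toFinset (fun p => (wt p : ℝ)) (crossF (1 / 8) (-1) (QN (Nd + 1) 0 Δ)) +
        (1 / 2 : ℝ) ^ (1 / 8 : ℝ) * (1 / 2 : ℝ) ^ (1 / 8 : ℝ) * (2 * absWeight Sl.toFinset (fun p => (wt p : ℝ))) *
          ((4 * tailMajor Λ (Nd + 1 + 2)) * (2 * headMajor Λ (Nd + 1) + 4 * tailMajor Λ (Nd + 1 + 2))) ≤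
      -epsLowerMargin Λ Nd (((a : ℝ) + L) / q) := by
  have hqR : (0 : ℝ) < q := by exact_mod_cast hq
  have hΔ : 0 ≤ Δ := le_trans (by positivity) hlo
  obtain ⟨hylo, hyhi⟩ := half_mem_cell hq hlo hhi
  have h := evalR_nonneg_of_bernAuto_truncZ hq ha hL hqL hchk (y := Δ / 2) hylo hyhi
  exact epsSignLower_of_evalR_nonneg wt hnd hΛ Nd hΛN hΔ hyhi h

/-! ### The LOWER sign leaf from the polynomial inequality (SHARP tail) -/

set_option maxHeartbeats 800000 in
/-- The sign check of `opeEpsLower_half_of_cellsN_sharp` at `Δ` with the margin at any `y₂ ≥ Δ/2`, from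
`0 ≤ (epsLowerPolyZB - 1)(Δ/2)` (`0 ≤ Δ`, `2Λ < Nd + 3`): the body of `epsSignLowerB_of_bernAuto_trunc`. [folklore] -/
theorem epsSignLowerB_of_evalR_nonneg (wt : ℕ × ℕ → ℤ) {Sl : List (ℕ × ℕ)} (hnd : Sl.Nodup) {Λ : ℕ}
    (hΛ : ∀ p ∈ Sl, p.1 + p.2 ≤ Λ) (Nd : ℕ) (hΛN : 2 * Λ < Nd + 3) {Δ y₂ : ℝ} (hΔ : 0 ≤ Δ) (hy₂ : Δ / 2 ≤ y₂)
    (h : 0 ≤ evalR (castZ (zadd (epsLowerPolyZB wt Sl Λ Nd) [-1])) (Δ / 2)) :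
    (2 : ℝ) ^ Δ * taylorFunctional2D (1 / 2) Sl.toFinset (fun p => (wt p : ℝ)) (crossF (1 / 8) (-1) (QN (Nd + 1) 0 Δ)) +
        (1 / 2 : ℝ) ^ (1 / 8 : ℝ) * (1 / 2 : ℝ) ^ (1 / 8 : ℝ) * (2 * absWeight Sl.toFinset (fun p => (wt p : ℝ))) *
          (tailMajorB Λ (Nd + 1) * (2 * headMajorB Λ (Nd + 1) + tailMajorB Λ (Nd + 1))) ≤
      -epsLowerMarginB Λ Nd y₂ := by
  rw [evalR_zadd] at h
  have hm1 : evalR (castZ [-1]) (Δ / 2) = -1 := by simp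
  rw [hm1] at h
  -- atoms
  set Pv := evalR (castZ (cellPolyZ wt Sl Λ 0 Nd)) (Δ / 2) with hPv
  set DD := denProd Nd 0 (Δ / 2) * denProd Nd 0 (Δ / 2) with hDD
  set c1 : ℝ := ((epsC1B Λ Nd : ℕ) : ℝ) with hc1
  set Kr : ℝ := ((epsKZB wt Sl Λ Nd : ℤ) : ℝ) with hKr
  set c2 : ℝ := (1 / 2 : ℝ) ^ (1 / 8 : ℝ) * (1 / 2 : ℝ) ^ (1 / 8 : ℝ) with hc2def
  set Wr := absWeight Sl.toFinset (fun p => (wt p : ℝ)) with hWr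
  set X := (2 : ℝ) ^ Δ * taylorFunctional2D (1 / 2) Sl.toFinset (fun p => (wt p : ℝ)) (crossF (1 / 8) (-1) (QN (Nd + 1) 0 Δ)) with hX
  set Tr := c2 * (2 * Wr) * (tailMajorB Λ (Nd + 1) * (2 * headMajorB Λ (Nd + 1) + tailMajorB Λ (Nd + 1))) with hTr
  have hev : evalR (castZ (epsLowerPolyZB wt Sl Λ Nd)) (Δ / 2) = -c1 * Pv - Kr * DD := by
    rw [epsLowerPolyZB, evalR_zadd, evalR_zsmul, evalR_zsmul, evalR_zmul, evalR_dpolyZ, hc1, hKr, hPv, hDD]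
    push_cast
    ring
  rw [hev] at h
  -- positivity of the atoms
  have hc2pos : 0 < c2 := by
    have : (0 : ℝ) < (1 / 2 : ℝ) ^ (1 / 8 : ℝ) := Real.rpow_pos_of_pos (by norm_num) _
    rw [hc2def]; positivity
  have hD : 0 < denProd Nd 0 (Δ / 2) := denProd_pos Nd 0 (by push_cast; linarith)
  have hDm : denProd Nd 0 (Δ / 2) ≤ denProd Nd 0 y₂ := denProd_zero_mono Nd (by linarith) hy₂
  have hc1pos : 0 < c1 := by rw [hc1]; exact_mod_cast epsC1B_pos hΛN
  have hdpos : 0 < Nd + 1 + 2 - 2 * Λ := by omega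
  have hdR : (((Nd + 1 + 2 - 2 * Λ : ℕ)) : ℝ) = (Nd : ℝ) + 3 - 2 * Λ := by
    rw [Nat.cast_sub (by omega)]; push_cast; ring
  have hd1R : (((Nd + 1 + 2 - Λ : ℕ)) : ℝ) = (Nd : ℝ) + 3 - Λ := by
    rw [Nat.cast_sub (by omega)]; push_cast; ring
  set M1 : ℝ := 8 ^ Λ * (Λ.factorial : ℝ) * (Λ.factorial : ℝ) * (4 : ℝ) ^ Nd * DD with hM1
  have hM1pos : 0 < M1 := by rw [hM1, hDD]; positivity
  -- the block identity `M1 · X = c2 · P̂₀(y)`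
  have hQ : M1 * X = c2 * Pv := by
    have hkey := two_rpow_mul_phiQ_eq wt hnd hΛ Nd hΔ
    rw [pow_two] at hkey
    rw [hM1, hDD, hX, hc2def, hPv]
    linear_combination hkey
  -- the tail identity `M1 · Tr · c1 = c2 · Kr · DD`
  have hW := cast_wabsZ wt hnd
  have hσ : tailMajorB Λ (Nd + 1) = ((epsAB Λ Nd : ℕ) : ℝ) / (2 ^ (Nd + 1) * (((Nd + 1 + 2 - 2 * Λ : ℕ)) : ℝ)) := by
    rw [tailMajorB, epsAB, bndBK_eq, hdR, one_div_pow, Nat.cast_mul, Nat.cast_mul, hd1R]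
    have hne : (Nd : ℝ) + 3 - 2 * Λ ≠ 0 := by rw [← hdR]; exact_mod_cast hdpos.ne'
    have e2 : ((Nd + 1 : ℕ) : ℝ) + 2 - 2 * Λ = (Nd : ℝ) + 3 - 2 * Λ := by push_cast; ring
    have e1 : ((Nd + 1 : ℕ) : ℝ) + 2 - Λ = (Nd : ℝ) + 3 - Λ := by push_cast; ring
    rw [e1, e2, eq_div_iff (mul_ne_zero (by positivity) hne)]
    field_simp
    push_cast
    ring
  have hH : headMajorB Λ (Nd + 1) = ((headMajorBK Λ (Nd + 1) (Nd + 1) : ℕ) : ℝ) / 2 ^ (Nd + 1) := by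
    rw [headMajorB_eq, headMajorBK_eq, headMajorBZ]
  have hT : M1 * Tr * c1 = c2 * Kr * DD := by
    rw [hTr, hσ, hH, hM1, hKr, hc1, hWr, ← hW, epsKZB, epsC1B]
    have hd0 : (((Nd + 1 + 2 - 2 * Λ : ℕ)) : ℝ) ≠ 0 := by exact_mod_cast hdpos.ne'
    have h4 : (4 : ℝ) ^ (Nd + 1) = 2 ^ (Nd + 1) * 2 ^ (Nd + 1) := by rw [← mul_pow]; norm_num
    push_cast
    rw [h4]
    field_simp
  -- `h : 0 ≤ -c1 Pv - Kr DD - 1` ⇒ `M1 (X + Tr) c1 = c2 (c1 Pv + Kr DD) ≤ -c2`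
  have hsum : M1 * (X + Tr) * c1 ≤ -c2 := by
    have h3 : c1 * Pv + Kr * DD ≤ -1 := by linarith
    have h4 : M1 * (X + Tr) * c1 = c2 * (c1 * Pv + Kr * DD) := by
      calc M1 * (X + Tr) * c1 = c1 * (M1 * X) + M1 * Tr * c1 := by ring
        _ = c1 * (c2 * Pv) + c2 * Kr * DD := by rw [hQ, hT]
        _ = c2 * (c1 * Pv + Kr * DD) := by ring
    rw [h4]
    have h5 := mul_le_mul_of_nonneg_left h3 hc2pos.le
    linarith
  have hle1 : X + Tr ≤ -c2 / (M1 * c1) := by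
    rw [le_div_iff₀ (mul_pos hM1pos hc1pos)]
    nlinarith [hsum]
  -- the margin at `Δ/2` dominates the one at the right end `y₂`
  have hmargin : epsLowerMarginB Λ Nd y₂ ≤ c2 / (M1 * c1) := by
    unfold epsLowerMarginB
    rw [← hc2def, ← hc1, hM1, hDD]
    have hD2 : 0 < denProd Nd 0 y₂ := lt_of_lt_of_le hD hDm
    rw [div_le_div_iff₀ (by positivity) (by positivity)]
    have hsq : denProd Nd 0 (Δ / 2) * denProd Nd 0 (Δ / 2) ≤ (denProd Nd 0 y₂) ^ 2 := by
      rw [pow_two]; exact mul_le_mul hDm hDm hD.le hD2.le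
    have hrest : 0 ≤ c2 * (8 ^ Λ * (Λ.factorial : ℝ) * (Λ.factorial : ℝ) * (4 : ℝ) ^ Nd * c1) := by positivity
    nlinarith [mul_le_mul_of_nonneg_left hsq hrest]
  have hneg : -c2 / (M1 * c1) = -(c2 / (M1 * c1)) := neg_div _ _
  rw [hneg] at hle1
  linarith

/-- **LOWER sign leaf with the SHARP integer tail, ZERO-TAIL truncation**: as `epsSignLowerB_of_bernAuto_trunc` with
`bernAuto (ptruncZ (epsLowerPolyZB - 1) m) q a L = true` and the extra cell condition `a + L ≤ q` (`y ≤ 1`). [folklore] -/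
theorem epsSignLowerB_of_bernAuto_truncZ (wt : ℕ × ℕ → ℤ) {Sl : List (ℕ × ℕ)} (hnd : Sl.Nodup) {Λ : ℕ}
    (hΛ : ∀ p ∈ Sl, p.1 + p.2 ≤ Λ) (Nd m : ℕ) (hΛN : 2 * Λ < Nd + 3) {q a L : ℤ} (hq : 0 < q) (ha : 0 ≤ a) (hL : 0 ≤ L)
    (hqL : a + L ≤ q) (hchk : bernAuto (ptruncZ (zadd (epsLowerPolyZB wt Sl Λ Nd) [-1]) m) q a L = true) {Δ : ℝ}
    (hlo : 2 * (a : ℝ) / q ≤ Δ) (hhi : Δ ≤ 2 * ((a : ℝ) + L) / q) :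
    (2 : ℝ) ^ Δ * taylorFunctional2D (1 / 2) Sl.toFinset (fun p => (wt p : ℝ)) (crossF (1 / 8) (-1) (QN (Nd + 1) 0 Δ)) +
        (1 / 2 : ℝ) ^ (1 / 8 : ℝ) * (1 / 2 : ℝ) ^ (1 / 8 : ℝ) * (2 * absWeight Sl.toFinset (fun p => (wt p : ℝ))) *
          (tailMajorB Λ (Nd + 1) * (2 * headMajorB Λ (Nd + 1) + tailMajorB Λ (Nd + 1))) ≤
      -epsLowerMarginB Λ Nd (((a : ℝ) + L) / q) := by
  have hqR : (0 : ℝ) < q := by exact_mod_cast hq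
  have hΔ : 0 ≤ Δ := le_trans (by positivity) hlo
  obtain ⟨hylo, hyhi⟩ := half_mem_cell hq hlo hhi
  have h := evalR_nonneg_of_bernAuto_truncZ hq ha hL hqL hchk (y := Δ / 2) hylo hyhi
  exact epsSignLowerB_of_evalR_nonneg wt hnd hΛ Nd hΛN hΔ hyhi h

end Summit.CriticalPhenomena.Ising3D.Control2D
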